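import Literature.NumberTheory.Automorphic.ShimuraCurve
import Literature.NumberTheory.EllipticCurves.Isogeny
import Literature.NumberTheory.EllipticCurves.Szpiro
import HarnessLib
import Literature.NumberTheory.EllipticCurves.IsogenyIdProofs
import Literature.NumberTheory.EllipticCurves.SzpiroOfAbcProofs
import Literature.NumberTheory.EllipticCurves.PastenHeightBounds
import Literature.NumberTheory.EllipticCurves.GlobalMinimalModelProofs
import Literature.NumberTheory.EllipticCurves.ModularDegreeFormulaProofs
import Literature.NumberTheory.EllipticCurves.ModularCurveManinConstantProofs

/-!
# Shimura-curve parametrisations: Jacquet–Langlands existence, the refined Ribet–Takahashi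
# formula (Pasten Thm 6.1), Frey's identity, the norm comparison (Thm 8.1), and the classical
# inputs of Pasten §16 (Manin constant, `‖f‖² ≪ N log N`, Shimizu's volume)

Named facts (`def … : Prop`, D-0014; results IN PRINT, cited with page locators, not proved here)
over the vocabulary of `Literature/NumberTheory/Automorphic/ShimuraCurve.lean`, plus the two
definitions they need (`ShimuraParametrizationData.IsMinimalFor`, `IsFreyHellegouarch`). They are
exactly the inputs of the proof of Pasten's Thm 16.4 (p. 50; = the Jacquet–Langlands package of
route `ABC/RibetTakahashiSplit`, crux `ManyPrimeValuationProduct`, line `jl-zero-cycle-height`),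
in the order of that proof: (EqUsingRT) ← Thm 6.1 (b); (EqFreyClassical) is the tree's PROVED
`ModularParametrizationData.zagier_degree_formula_holds`; (Eqdnfje)/(EqFreyQuaternionic) ←
`normSq_form_eq_deg_mul_covolume` + `minimalDegree_le_163_mul` (the latter is the theorem of
Mazur–Kenku, tree fact `Literature.NumberTheory.EllipticCurves.mazurKenku_exists_cyclic_isogeny`, in
Shimura-curve clothing: PROVED from it as `minimalDegree_le_163_mul_of_mazurKenku` in
`ShimuraCurveMinimalDegreeIsogenyBoundProofs.lean`); `|h(A_{1,N}) − h(A_{D,M})| ≤ ½ log 163`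
is the tree's `abs_neronLatticeHeight_sub_le_of_isIsogenous`; `‖f‖² ≪ N log N` ←
`murty_petersson_newform_upper_bound`; the Manin constant ← `PastenShimura2024_cor_10_2`
(semistable case: tree `abs_maninConstant_eq_one_of_isSemistable`), applied to the optimal datum
of `exists_optimal_modularParametrizationData` (`q_{1,N} j_N`, degree `δ_{1,N}`, `c = c_f`).

Source: H. Pasten, *Shimura curves and the abc conjecture*, J. Number Theory 254 (2024) 214–335
= arXiv:1705.09251 [PastenShimura2024], READ in the held arXiv text: §2 p. 12, §3 p. 13, §4
pp. 14–16, §5 p. 17, Thm 6.1 p. 20, Lemma 6.8 p. 22, §8.1 Thm 8.1 p. 29, Cor 10.2 p. 33, §16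
pp. 49–50. M.-F. Vignéras, LNM 800 [VignerasLNM800], Ch. III Thm 3.1, Ch. IV §1, §2 Prop 2.10,
§3.A (held text, read).

## Rendering of `δ_{1,N}` and `δ_{D,M}` (the tree's minimal-degree idiom)

Pasten §2 p. 12: `q_{D,M} : J₀^D(M) → A_{D,M}` is the optimal quotient (Jacquet–Langlands) with
`A_{D,M}` isogenous to `E`, and `q_{D,M} q_{D,M}^∨ = [δ_{D,M}]`. As in
`Literature.NumberTheory.EllipticCurves.ModularForms.PastenShimura2024_thm_5_5`,
`E` is a globally minimal `W` (so `IsNewformOf W f` pins the newform `f_E` and the data lattices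
are Néron lattices); `δ_{1,N}(E)` = `D₁.modularDegree` for a classical datum
`D₁ : ModularParametrizationData W₁ N` with `IsNewformOf W D₁.f` (the newform of the class) of
minimal degree among all data at level `N` with that newform; and `δ_{D,M}(E)` = `P.deg` for a
Shimura datum `P` with `P.IsMinimalFor W` (`ℚ`-isogeny class via the tree's
`WeierstrassCurve.IsIsogenous`; docstring of `IsMinimalFor`: `q ∘ j_{p₀}` has degree `δ_{D,M}`,
proof of Prop 5.1 p. 17, and every datum of the class factors through `q`). A positive rational `x` has
numerator `≤ T` supported on primes `≤ 163` iff `x = a/b` for SOME positive integers `a, b` with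
`a ≤ T` supported on primes `≤ 163` (the numerator divides every such `a`); the denominator of `x`
divides `k` iff `x = a/b` for some `a, b > 0` with `b ∣ k`. Thm 6.1 is rendered in this form for
`x = γ_{D,M,E} = (δ_{1,N}/δ_{D,M}) / ∏_{p∣D} v_p(Δ_E)`.

## Not here

Thm 6.1 (a) (general `S`); Thm 1.6/14.1 and the integral lattice `𝒮₂^D(M)` (not needed by the
package; an `∃ Sint`-closed rendering would only restate the eigenform bound — review of the
2026-08-15 proposal, point 3); effectivity clauses; the classical case `D = 1` of Frey's identity
(tree, proved).

## References

* [PastenShimura2024] H. Pasten, J. Number Theory 254 (2024) = arXiv:1705.09251, loc. cit.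
* [VignerasLNM800] M.-F. Vignéras, *Arithmétique des algèbres de quaternions*, LNM 800 (1980).
* [RibetTakahashi1997] K. Ribet, S. Takahashi, PNAS 94 (1997) 11110–11114 (the formula refined by
  Thm 6.1). [Mazur1978] B. Mazur, Invent. Math. 44; [Kenku1982] M. A. Kenku, J. Number Theory 15
  (isogeny degrees `≤ 163`). [ZagierCMB1985] D. Zagier, Canad. Math. Bull. 28, §1 (Frey's identity
  on `X₀(N)`). [Shimizu1963] H. Shimizu, Ann. of Math. 77 (volumes). [JacquetLanglands1970].
  [MurtyCongruencePrimes1999] M. R. Murty, *Bounds for congruence primes*, §2 (read in the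
  author's preprint); [MaiMurty1994] L. Mai, M. R. Murty, Contemp. Math. 166, §2 (read in the
  authors' preprint: "`L(1, Sym²(f)) = O((log N)³)`" — see the caveat on
  `murty_petersson_newform_upper_bound`).
-/

noncomputable section

open scoped MatrixGroups ModularForm
open _root_.MeasureTheory UpperHalfPlane CongruenceSubgroup

namespace Literature.NumberTheory.Automorphic

open Literature.NumberTheory.EllipticCurves.ModularForms
  (IsNeronLatticeOf ModularParametrizationData IsNewformOf peterssonProduct gamma0Index)
open Literature.NumberTheory.EllipticCurves (freyCurve)

/-! ### The two remaining definitions -/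

namespace ShimuraParametrizationData

variable {D M : ℕ} {X : ShimuraCurveData D M}

/-- **`P` realises the `(D, M)`-modular degree `δ_{D,M}(W)`**: `P` parametrises a curve `W'`
that is `ℚ`-isogenous to `W` (tree `WeierstrassCurve.IsIsogenous`) and has the least degree among
all data on `X` of all elliptic curves `ℚ`-isogenous to `W`. Pasten §2 p. 12 defines `δ_{D,M}(E)`
by `q_{D,M} q_{D,M}^∨ = [δ_{D,M}]` for the optimal quotient `q_{D,M} : J₀^D(M) → A_{D,M}`
(Jacquet–Langlands; `A_{D,M}` isogenous to `E`); by the proof of Prop. 5.1 (p. 17) the `ℂ`-map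
`q ∘ j_{p₀} : X₀^D(M)_ℂ → A_{D,M,ℂ}` "has degree equal to the modular degree `δ`", and every datum
`P''` of a curve of the class factors as `λ ∘ q ∘ j_{p₀} + c`, `λ ≠ 0` (Albanese property; the
Hecke condition with multiplicity one, §4.9/§4.11, puts `φ^•(du)` in the `χ₀`-line, so the induced
`J_ℂ → W''_ℂ` kills `ker q = 𝕀_{[χ₀]} J = Σ_{[χ] ≠ [χ₀]} B_{[χ]}`), of degree
`deg λ · δ_{D,M} ≥ δ_{D,M}`. Hence `P.IsMinimalFor W` iff `W ∼ W'` and `P.deg = δ_{D,M}(W)` —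
the idiom of `PastenShimura2024_thm_5_5` for `δ_{1,N}`. [cite: PastenShimura2024, §2 p. 12 (δ_{D,M}) and proof of Prop. 5.1 p. 17] -/
def IsMinimalFor {W' : WeierstrassCurve ℚ} (P : ShimuraParametrizationData X W')
    (W : WeierstrassCurve ℚ) : Prop :=
  W.IsIsogenous W' ∧ ∀ (W'' : WeierstrassCurve ℚ) [W''.IsElliptic]
    (P'' : ShimuraParametrizationData X W''), W.IsIsogenous W'' → P.deg ≤ P''.deg

end ShimuraParametrizationData

/-- **`W` is a Frey–Hellegouarch curve**: `W` is `ℚ`-isomorphic (Mathlib `VariableChange`) to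
`E_{a,b,c} : y² = x(x − a)(x + b)` for coprime positive integers `a, b` (`c = a + b`) — Pasten §3
p. 13: "Given a triple `a,b,c` of coprime positive integers with `a+b=c`, the Frey–Hellegouarch
elliptic curve `E_{a,b,c}` is defined by the affine equation `y² = x(x−a)(x+b)`" (no congruence
conditions); the tree's `freyCurve a b`. The class of Thm 6.1 (b.2). [cite: PastenShimura2024, §3 p. 13 (Frey–Hellegouarch curve)] -/
def IsFreyHellegouarch (W : WeierstrassCurve ℚ) : Prop :=
  ∃ (a b : ℕ) (C : WeierstrassCurve.VariableChange ℚ),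
    0 < a ∧ 0 < b ∧ Nat.Coprime a b ∧ C • W = freyCurve a b

/-! ### Existence of the data (Vignéras; Jacquet–Langlands) -/

/-- **Shimura curve data exist for every admissible level.** For `N = D M` admissible there is a
quaternion algebra `B/ℚ` ramified exactly at the (evenly many) primes dividing `D` (Vignéras III
Thm 3.1, classification: any finite set of places of even cardinality — here no infinite place, so
`B ⊗ ℝ ≅ M₂(ℝ)` and a real splitting `ι` exists), an Eichler order of every level `M` prime to `D`
(intersect a maximal order with a conjugate, locally `(ℤ_p ℤ_p; p^e ℤ_p ℤ_p)`; Vignéras III §5,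
II §2), and the discrete group `ι(O¹) ≤ SL₂(ℝ)` has a (Dirichlet/Ford) fundamental polygon, in
particular a measurable a.e.-exact fundamental domain (Vignéras IV §1). Pasten §2 p. 12 / §4.1
p. 14 takes all of this as the definition of `X₀^D(M)`. [cite: VignerasLNM800, Ch. III Thm. 3.1 and Ch. IV §1] -/
def nonempty_shimuraCurveData : Prop :=
  ∀ {N D M : ℕ}, IsAdmissibleFactorization N D M → Nonempty (ShimuraCurveData D M)

/-- **The hyperbolic area of `X₀^D(M)`** (Shimizu; Vignéras IV §3.A, held text: for the
congruence group of level `N = N₀N₁N₂` in `H ⊆ M(2,ℝ)` of reduced discriminant `D`, the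
Euler–Poincaré volume is `vol_a(Γ̄\ℋ₂) = −(1/6) ∏_{p∣D}(p−1) · N₀N₁²N₂³ ∏_{p∣N₀}(1+p⁻¹)
∏_{p∣N₁N₂}(1−p⁻²)`, with `vol_a = −vol/(2π)` for the hyperbolic measure `dx dy/y²` (IV §2, before
Prop 2.10); here `N₀ = M`, `N₁ = N₂ = 1`, `Γ = O¹`): for every datum `X` of level `(D, M)`,
`M ≥ 1`, the fundamental domain has measure
`vol(X.fd) = (π/3) φ(D) ψ(M)`, `ψ(M) = M ∏_{p∣M}(1 + 1/p)` = the tree's `gamma0Index M`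
(any two a.e.-exact measurable fundamental domains of `Γ ∋ -1` have the same measure).
[cite: VignerasLNM800, Ch. IV §3.A (volume of congruence groups), with Ch. IV §2] [cite: Shimizu1963] -/
def ShimuraCurveData.volume_fd_eq : Prop :=
  ∀ {D M : ℕ} (X : ShimuraCurveData D M), 0 < M →
    volume X.fd = ENNReal.ofReal (Real.pi / 3 * ((Nat.totient D * gamma0Index M : ℕ) : ℝ))

/-- **Jacquet–Langlands parametrisations exist.** Pasten §2 p. 12: "for each admissible
factorization `N = DM`, the Jacquet–Langlands correspondence gives an optimal quotient
`q_{D,M} : J₀^D(M) → A_{D,M}` defined over `ℚ`, with `A_{D,M}` isogenous to `E`" (`E/ℚ` of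
conductor `N`; §4.10–4.11 p. 16 for the construction), and Prop. 5.1 p. 17: "`φ_{D,M,n} = q j_{D,M,n}
: X₀^D(M) → A` is non-constant of degree `(a_n(A) − σ₁(n))² · δ`". Recorded over the tree as the
consequence the route consumes: for `W/ℚ` a globally minimal elliptic curve of conductor `N = D M`
(admissible) and any datum `X` of level `(D, M)`, composing `φ_{D,M,n}` (or `q ∘ j_{p₀}` over `ℂ`)
with an isogeny `A_{D,M} → E ≅ W` and pulling back `du` along the uniformisation `ℂ/Λ_W ≅ W(ℂ)`
gives a datum: a weight-`2` form on `Γ₀^D(M)` with periods in `Λ_W`, in the Hecke line of `W`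
(`a_ℓ(A_{D,M}) = a_ℓ(W)`, isogenous; Mathlib's `WeierstrassCurve.LFunction` is built from local
minimal models, so its coefficients are the `a_ℓ(E)` for every model), of positive degree with the fibre count of a non-constant map of compact Riemann
surfaces (for `D = 1`: finitely many cusp images excluded as well).

**Status (review of 2026-08-16, source open: §2 p. 12, §4.10–4.11 p. 16, Prop. 5.1 p. 17;
updated 2026-08-16 after the reduction files landed).** A faithful consequence of theorems in print
and an apex of the tree: for `D = 1` it is the Modularity theorem with the Eichler–Shimura
construction and Faltings' isogeny theorem, transported to an arbitrary presentation `ι(O¹)` of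
`Γ₀(N)`; for `D > 1` it is the Jacquet–Langlands correspondence (§4.10) with Shimura's construction
`q_{[χ]}` (§4.11) on top of them. Audited against Mathlib's semantics: `CuspForm Γ 2` for
`Γ ≤ GL(2, ℝ)` imposes vanishing exactly at the fixed points of parabolic elements of `Γ` (none for
`D > 1`, the cusps of `ι(O¹)` for `D = 1`); with the slash action
`(h ∣[2] α)(τ) = det α · j(α, τ)⁻² h(ατ)` the operator `X.heckeFun ℓ` (sum over the `ℓ + 1` cosets
`O¹ \ O(ℓ)`, `ℓ ∤ DM`) has eigenvalue `a_ℓ` on the line of a normalised newform; the period and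
fibre-count clauses are those of `q ∘ j_{p₀}` composed with an isogeny. Not mis-stated, not open,
not provable inline. PROVED towards it (theorems only, zero debt): (a) the fact is equivalent to its
automorphic half (`nonempty_shimuraParametrizationData_iff_automorphicHalf`,
`ShimuraParametrizationExistenceProofs`) and the `D > 1` degree clause is a theorem
(`ShimuraCurveData.exists_deg_of_hasPeriodsIn`, `ShimuraCurveMapDegreeProofs`), so the fact follows
from its `D = 1` half and, for `D > 1`, a non-zero `T_ℓ`-eigenform on `Γ₀^D(M)` with eigenvalues
`a_ℓ(W)` and periods in `Λ_W` (`nonempty_shimuraParametrizationData_of_one_and_eigenform`); (b) the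
`D = 1` half is a theorem relative to the Modularity theorem ALONE — the transport of the newform of
`W` from `X₀(N)` to an arbitrary presentation `ι(O¹)` (`B ≅ M₂(ℚ)` for `Ram(B) = ∅`, conjugacy of
Eichler orders of level `N` in `M₂(ℚ)`, Skolem–Noether over `ℝ`, Hecke operators and fibre counts
along the conjugation) is `automorphicHalf_one_of_exists_isNewformOf`
(`ShimuraParametrizationSplitCaseProofs`), whence
`nonempty_shimuraParametrizationData_of_exists_isNewformOf (hmod) (hJL)`; relative to a
`ModularParametrizationData W N` it is unconditional
(`nonempty_shimuraParametrizationData_one_of_modularParametrizationData`,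
`ShimuraParametrizationRelativeProofs`; with the degree, `ShimuraParametrizationSplitDegreeProofs`);
(c) for `D > 1` the eigenform input `hJL` splits along the printed proof into the Jacquet–Langlands
transfer of the newform to `Γ₀^D(M)` (§4.10; Darmon, CBMS 101, Thm. 4.12) and Shimura's
construction on `J₀^D(M)` (§4.11), Faltings' theorem and the commensurability of Néron lattices
being theorems of the tree:
`nonempty_shimuraParametrizationData_of_exists_isNewformOf_of_transfer_of_shimuraConstruction`
(`ShimuraParametrizationIsogenyProofs`) — these two `D > 1` statements have no declaration in the
tree; (d) conversely, the fact IMPLIES the analytic modularity of every elliptic curve over `ℚ` (a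
non-zero `T_ℓ`-eigenform in `S₂(Γ₀(N_E))` with eigenvalues `a_ℓ(E)`, `ℓ ∤ N_E`; for globally
minimal `E` with Néron periods and a degree on `Y₀(N_E)`):
`exists_heckeEigenform_of_nonempty_shimuraParametrizationData`,
`classicalHalf_of_nonempty_shimuraParametrizationData`, and the characterisations
`nonempty_shimuraParametrizationData_iff_classicalHalf_and_eigenform`,
`nonempty_shimuraParametrizationData_iff_eigenform_of_exists_isNewformOf`
(`ShimuraParametrizationSplitCaseConverseProofs`) — modulo the tree's root fact
`Literature.NumberTheory.EllipticCurves.ModularForms.exists_isNewformOf`, on which this fact is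
parked, it is EXACTLY its `D > 1` Jacquet–Langlands half. **Relative form.** Relative to the
modularity of `W` (a hypothesis `Nonempty (ModularParametrizationData W N)`, `[NeZero N]` — the cut
used by `exists_optimal_modularParametrizationData` below) the fact records the Jacquet–Langlands
step alone, as the source attributes it ("the modularity theorem … associates to `E` a unique … `f`
… More generally, for each admissible factorization `N = DM`, the Jacquet–Langlands correspondence
gives an optimal quotient `q_{D,M}`"); the relative form is proved at `D = 1` and reduced to `hJL`
at `D > 1` (`relative_of_eigenform`, `ShimuraParametrizationRelativeProofs`), and Pasten's two-prime
package no longer consumes this fact (`ShimuraCurveRibetTakahashiPairwiseNoJLProofs`). [cite: PastenShimura2024, §2 p. 12 (q_{D,M}, Jacquet–Langlands) and Prop. 5.1 p. 17] [cite: JacquetLanglands1970] -/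
def nonempty_shimuraParametrizationData : Prop :=
  ∀ {N D M : ℕ}, IsAdmissibleFactorization N D M →
    ∀ (X : ShimuraCurveData D M) (W : WeierstrassCurve ℚ) [W.IsElliptic] [W.IsGloballyMinimal],
      W.conductorNorm ℤ = N → Nonempty (ShimuraParametrizationData X W)

/-! ### Frey's identity and the Mazur–Kenku comparison -/

/-- **Frey's identity `‖φ^•du‖² = deg(φ) · covol(Λ)`** for a Shimura-curve parametrisation datum:
`∫_{X.fd} |P.form|² (Im z)² dμ = P.deg · covol(Λ_L)` (Lebesgue covolume of `P.L.lattice`, unit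
square of area `1`). This is the change of variables for the degree-`deg` holomorphic map
`φ : Γ\ℍ → ℂ/Λ_L`: `|form|² dx dy = φ^*(dA)`, each generic point having `deg` preimage orbits
(`deg_spec`), and `μ = dx dy/y²` (Mathlib `volume` on `ℍ`). GENERAL FOLKLORE STATEMENT; Pasten
proves the instance `φ_{D,M}`, (EqFreyQuaternionic) p. 49: "`log deg φ_{D,M} = 2 log ‖f_{D,M}‖_{U₀^D(M),2}
+ 2h(A_{D,M})`" with `h(A) = −½ log((i/2)∫ω∧ω̄) = −½ log covol` (§3 p. 13) — "by the same argument
as the proof of (EqFrey)"; the general case is the same change of variables. The classical twin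
(`D = 1`, with the factor `4π²c²` of `2πi c f dτ`) is Zagier 1985 §1 = the tree's PROVED
`ModularParametrizationData.zagier_degree_formula_holds`. [folklore] -/
def ShimuraParametrizationData.normSq_form_eq_deg_mul_covolume : Prop :=
  ∀ {D M : ℕ} {X : ShimuraCurveData D M} {W : WeierstrassCurve ℚ} [W.IsElliptic]
    (P : ShimuraParametrizationData X W),
    X.normSq P.form = P.deg * ZLattice.covolume P.L.lattice

/-- **The minimal parametrisation degree of a curve of the class is at most `163 · δ_{D,M}`.**
Pasten §16 p. 49: "Since `A_{1,N}` and `A_{D,M}` are both isogenous to `E`, they are connected by an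
isogeny of degree `≤ 163`", and Lemma 6.8 (proof, p. 22): "Let `α : A → B` be an isogeny of
minimal degree; by results of Mazur and Kenku we know that `n := deg(α) ≤ 163`". Composing the
degree-`δ_{D,M}` map `q ∘ j_{p₀} : X₀^D(M)_ℂ → A_{D,M,ℂ}` (proof of Prop. 5.1) with a minimal isogeny
`A_{D,M} → E'` (`E'` any curve of the class) is a datum of `E'` of degree `≤ 163 δ_{D,M}` (the
pulled-back form stays in the Hecke line; no integrality constraint is imposed on data). Recorded
over the tree (the idiom of `PastenShimura2024_minimalDegree_le_163_mul`, its `D = 1` twin): if `P`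
realises `δ_{D,M}(W')` (`P.IsMinimalFor W'`) and `P'` has minimal degree among the data of `W'`
itself, then `P'.deg ≤ 163 · P.deg`.

**Status (review of 2026-08-16).** Everything in the printed argument except the theorem of
Mazur–Kenku is PROVED in the tree: `ShimuraParametrizationData.minimalDegree_le_163_mul_of_mazurKenku`
(`ShimuraCurveMinimalDegreeIsogenyBoundProofs.lean`: the composite datum `[ψ] ∘ φ`, the rational
multiplier of a `ℚ`-isogeny, isogeny invariance of `L(E, s)`) derives this statement from the tree's
named fact `Literature.NumberTheory.EllipticCurves.mazurKenku_exists_cyclic_isogeny` (Mazur 1978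
Thm. 1 with Kenku 1982; equivalent to `mazur_isogeny_irreducible` plus the 84 minimal composite
levels, `RationalIsogenyDegreesProofs.lean`). So this statement is that fact's Shimura-curve
corollary and nothing more: its discharge is the one-liner
`minimalDegree_le_163_mul_of_mazurKenku mazurKenku_exists_cyclic_isogeny_holds` the moment the fact
lands, and a consumer (the package `jlPackage_printedClass_of_facts`) may equally take
`mazurKenku_exists_cyclic_isogeny` itself. [cite: PastenShimura2024, §16 p. 49 and Lemma 6.8 (proof, p. 22)] [cite: Mazur1978] [cite: Kenku1982] -/
def ShimuraParametrizationData.minimalDegree_le_163_mul : Prop :=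
  ∀ {D M : ℕ} {X : ShimuraCurveData D M} {W W' : WeierstrassCurve ℚ} [W.IsElliptic] [W'.IsElliptic]
    (P : ShimuraParametrizationData X W) (P' : ShimuraParametrizationData X W'),
    P.IsMinimalFor W' → (∀ P'' : ShimuraParametrizationData X W', P'.deg ≤ P''.deg) →
      P'.deg ≤ 163 * P.deg

/-! ### Pasten's refined Ribet–Takahashi formula (Thm 6.1) -/

/-- **Pasten 2024, Theorem 6.1 — the numerator of `γ_{D,M,E}` (unconditional).** Printed (p. 20):
"Let `E` be an elliptic curve over `ℚ` of conductor `N` and let `N = DM` be an admissible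
factorization. The numerator of `γ_{D,M,E}` is supported on primes `≤ 163` and it is bounded from
above by `163^{ω(D)}`. In particular, we have
`log δ_{1,N} ≤ log δ_{D,M} + log(∏_{p∣D} v_p(Δ_E)) + 5.1 · ω(D)`", where
`δ_{1,N}/δ_{D,M} = γ_{D,M,E} · ∏_{p∣D} v_p(Δ_E)` (display (6.1)), `Δ_E` the minimal discriminant
(`W.minimalDiscriminantNorm ℤ`), `v_p` its exponent, `ω(D) = #D.primeFactors`. Rendering (module
docstring): `E` = a globally minimal `W`, `δ_{1,N} = D₁.modularDegree` (class-minimal classical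
datum with the newform of `W`), `δ_{D,M} = P.deg` (`P.IsMinimalFor W`); conclusion: `δ_{1,N} · b = a · δ_{D,M} · ∏_{p∣D} v_p(Δ_E)` for some
`a, b ≥ 1` with `a ≤ 163^{ω(D)}` and every prime factor of `a` at most `163` (equivalent to the
printed numerator statement). Valid for EVERY admissible `N = DM`, no hypothesis on `E`
(the point the 2026-08-15 review insisted on); parts (a)/(b) on the denominator are separate.

**Status (review of 2026-08-16, source open: display (6.1) and Thm. 6.1 p. 20, §6.6 and Prop. 6.13
p. 23, §6.9 p. 25).** Audited verbatim against the printed numerator statement: `γ_{D,M,E}` defined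
by (6.1) with `Δ_E` the minimal discriminant, the bound `163^{ω(D)}` and the support `≤ 163`, for
every `E/ℚ` and every admissible `N = DM` (including `D = 1`, where the printed `γ_{1,N,E} = 1` is,
over the tree's two idioms for `δ_{1,N}`, the divisibility `δ_{1,N} ∣ deg P` — the tree's THEOREM
`ShimuraParametrizationData.modularDegree_dvd_deg`, `ShimuraParametrizationSplitDegreeProofs.lean`,
so the `D = 1` instance of this fact is proved; conversely `dvd_deg_of_PastenShimura2024_thm_6_1`).
A faithful statement of a theorem in print — not mis-stated, not open, and not a decomposition
child of another fact (it is the first assertion of the printed Thm. 6.1 itself; its printed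
consequence (EqUpperRT) is the tree's `PastenShimura2024_thm_6_1.log_le`,
`ShimuraCurveRibetTakahashiLogFormProofs.lean`). Not provable inline: Pasten's own proof (§6.9:
(EqSequentially) from Prop. 6.13 and Lemma 6.8, then the telescoping over `D = p₁r₁⋯pₙrₙ`) is
PERFORMED in the tree — `PastenShimura2024_thm_6_1_of_eqSequentially`,
`eqSequentially_of_prop_6_13_of_lemma_6_8` (`ShimuraCurveRibetTakahashiNumeratorProofs.lean`),
Lemma 6.8 reduced to Mazur–Kenku and the intermediate curves `X₀^d(prM)` supplied by the theorem
`nonempty_shimuraCurveData_holds` (`ShimuraCurveRibetTakahashiAssemblyProofs.lean`), the `D = 1`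
bridge discharged (`PastenShimura2024_thm_6_1_of_prop_6_13_of_mazurKenku'`,
`ShimuraCurveRibetTakahashiPairwiseDenominatorProofs.lean`) — so the discharge
`PastenShimura2024_thm_6_1_holds` is the one-liner
`PastenShimura2024_thm_6_1_of_prop_6_13_of_mazurKenku' hMK hP h613` and waits for exactly its three
inputs: the named facts `Literature.NumberTheory.EllipticCurves.mazurKenku_exists_cyclic_isogeny`
(`hMK`, Lemma 6.8: Mazur 1978 Thm. 1, Kenku 1982) and `nonempty_shimuraParametrizationData` (`hP`,
above: Jacquet–Langlands, parked on the Modularity theorem; needed for the class-minimal data at the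
intermediate levels `(d, prM)`, `d > 1`), and Prop. 6.13 (`h613`) = Ribet–Takahashi 1997 Thm. 2
("Except for the notation, this is Theorem 2 in [RiTa]", p. 23; `M` need not be squarefree), in the
tree's minimal-degree idiom with the component-group orders `i_p(d,prM)`, `j_r(dpr,M)` existential —
a theorem with NO declaration in Mathlib or the tree (Néron models and the component groups `Φ_p`
of `J₀^D(M)` and of `q_{D,M}`, Čerednik–Drinfeld and Deligne–Rapoport, Ribet's exact sequence). The
fact therefore stays a cited named fact, consumed as a hypothesis (`h61n` of the line
`jl_zero_cycle_height` under `Summits/ABC`).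
[cite: PastenShimura2024, Thm. 6.1 p. 20 (numerator statement and (EqUpperRT))] -/
def PastenShimura2024_thm_6_1 : Prop :=
  ∀ {N D M : ℕ} [NeZero N], IsAdmissibleFactorization N D M →
    ∀ (X : ShimuraCurveData D M) (W : WeierstrassCurve ℚ) [W.IsElliptic] [W.IsGloballyMinimal],
      W.conductorNorm ℤ = N →
    ∀ (W₁ : WeierstrassCurve ℚ) [W₁.IsElliptic] (D₁ : ModularParametrizationData W₁ N),
      IsNewformOf W D₁.f →
      (∀ (W₂ : WeierstrassCurve ℚ) [W₂.IsElliptic] (D₂ : ModularParametrizationData W₂ N),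
          D₂.f = D₁.f → D₁.modularDegree ≤ D₂.modularDegree) →
    ∀ (W' : WeierstrassCurve ℚ) [W'.IsElliptic] (P : ShimuraParametrizationData X W'),
      P.IsMinimalFor W →
        ∃ a b : ℕ, 0 < a ∧ 0 < b ∧ a ≤ 163 ^ D.primeFactors.card ∧
          (∀ p ∈ a.primeFactors, p ≤ 163) ∧
          D₁.modularDegree * b =
            a * P.deg * ∏ p ∈ D.primeFactors, (W.minimalDiscriminantNorm ℤ).factorization p

/-- **Pasten 2024, Theorem 6.1 (b) — the denominator of `γ_{D,M,E}` in the two special classes.**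
Printed (p. 20): "(b) There is an absolute integer constant `κ ≥ 1` supported on primes `≤ 163`
which satisfies the following: Suppose that either (b.1) `E` is semi-stable and `M` is not a prime
number; or (b.2) `E` is a Frey–Hellegouarch elliptic curve and `M` is divisible by at least two odd
primes. Then the denominator of `γ_{D,M,E}` divides `κ^{ω(D)}`. In particular,
`log(∏_{p∣D} v_p(Δ_E)) ≤ log δ_{1,N} − log δ_{D,M} + O(ω(D))` where the implicit constant is
absolute." Rendering as in `PastenShimura2024_thm_6_1`: semistable = tree `W.IsSemistable ℤ`,
Frey–Hellegouarch = `IsFreyHellegouarch` (up to `ℚ`-isomorphism; all quantities are isomorphism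
invariants), "two odd primes divide `M`" = `2 ≤ #(M.primeFactors ∖ {2})`; conclusion
`δ_{1,N} · b = a · δ_{D,M} · ∏ v_p(Δ_E)` with `a, b ≥ 1`, `b ∣ κ^{ω(D)}` (equivalent to the
printed divisibility). ONLY these two classes are printed: the extension to all curves semistable
away from `2` is Pasten's proof of Thm 6.17 run with `S = {2}`, not a statement of the paper, and
is NOT asserted here.

**Status (review of 2026-08-16, source open: Thm. 6.1 p. 20, §6.3–6.9 pp. 21–25).** Audited
verbatim against the printed (b): `κ` absolute, `≥ 1`, supported on primes `≤ 163`; the two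
classes exactly as printed, including `M = 1` in (b.1) (`1` is "not a prime number", and the printed
proof covers it: Thm. 6.17 (i) then switches only on primes `r ∣ D`, Lemma 6.15; Prop. 6.13 has no
hypothesis on `M`) and every coprime `a, b ≥ 1` in (b.2) (the triple `(1,1,2)` excluded by
Lemma 6.12 has `N = 32`, which admits no `M` with two odd primes); `D = 1` is the paper's trivial
case `γ_{1,N,E} = 1`, which over the tree's two idioms for `δ_{1,N}` is the divisibility
`deg P ∣ δ_{1,N}` (`deg_dvd_of_PastenShimura2024_thm_6_1_b`). A faithful statement of a theorem in
print — not mis-stated, not open, and not a decomposition child of another fact (it is the printed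
theorem itself). Not provable inline: Pasten's own §6.6–6.9 (Lemma 6.14, Lemmas 6.15–6.16,
Thm. 6.17, the telescoping of §6.9) is PROVED in the tree conditionally on the external theorems the
printed proof quotes — `PastenShimura2024_thm_6_1_b_of_ribetTakahashi_treeFacts`
(`ShimuraCurveRibetTakahashiCokernelProofs.lean`) and
`PastenShimura2024_thm_6_1_b_of_prop_6_13_bounded_of_mazurKenku`
(`ShimuraCurveRibetTakahashiDenominatorAssemblyProofs.lean`) — so the discharge waits exactly for:
Néron models and the component groups `Φ_p` of `J₀^D(M)` and of `q_{D,M}` (the orders `i_p`, `j_p`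
of §6.6) with Ribet–Takahashi 1997 Thm. 2 (= Prop. 6.13), Ribet's Eisenstein property and Lemma 6.7
(⟹ Lemma 6.14), `j_p ∣ #Φ_p(A_{D,M})`; the Diophantine Lemma 6.10 at `S ∋ 2` (Darmon–Granville,
Faltings) and Lemma 6.12 (Wiles, Ribet, Darmon–Merel); the named facts
`Literature.NumberTheory.EllipticCurves.mazurKenku_exists_cyclic_isogeny` (Lemma 6.8),
`mestreOesterle1989_thm_1` (Lemmas 6.10/6.11 for (b.1)) and `nonempty_shimuraParametrizationData`
(above; parked on the Modularity theorem and, for `D > 1`, Jacquet–Langlands); and the `D = 1`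
bridge. None of the geometric inputs has a statement in Mathlib or the tree. The fact therefore
stays a cited named fact, consumed as a hypothesis (`jlPackage_printedClass_of_facts` under
`Summits/ABC`). [cite: PastenShimura2024, Thm. 6.1 (b) p. 20] -/
def PastenShimura2024_thm_6_1_b : Prop :=
  ∃ κ : ℕ, 1 ≤ κ ∧ (∀ p ∈ κ.primeFactors, p ≤ 163) ∧
  ∀ {N D M : ℕ} [NeZero N], IsAdmissibleFactorization N D M →
    ∀ (X : ShimuraCurveData D M) (W : WeierstrassCurve ℚ) [W.IsElliptic] [W.IsGloballyMinimal],
      W.conductorNorm ℤ = N →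
      (W.IsSemistable ℤ ∧ ¬ M.Prime) ∨
        (IsFreyHellegouarch W ∧ 2 ≤ (M.primeFactors.erase 2).card) →
    ∀ (W₁ : WeierstrassCurve ℚ) [W₁.IsElliptic] (D₁ : ModularParametrizationData W₁ N),
      IsNewformOf W D₁.f →
      (∀ (W₂ : WeierstrassCurve ℚ) [W₂.IsElliptic] (D₂ : ModularParametrizationData W₂ N),
          D₂.f = D₁.f → D₁.modularDegree ≤ D₂.modularDegree) →
    ∀ (W' : WeierstrassCurve ℚ) [W'.IsElliptic] (P : ShimuraParametrizationData X W'),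
      P.IsMinimalFor W →
        ∃ a b : ℕ, 0 < a ∧ 0 < b ∧ b ∣ κ ^ D.primeFactors.card ∧
          D₁.modularDegree * b =
            a * P.deg * ∏ p ∈ D.primeFactors, (W.minimalDiscriminantNorm ℤ).factorization p

/-! ### The norm comparison (Thm 8.1) -/

/-- **Pasten 2024, Theorem 8.1 (over `ℚ`).** Printed (p. 29), for `F` totally real of degree `n`,
`B/F` a quaternion DIVISION algebra with exactly one split real place, `Γ_{U,g} = gUg⁻¹ ∩ B⁺ˣ`,
`‖h‖_{U,g,2} = (∫_{Γ̃\𝔥} |h|² Im(z)² dμ)^{1/2}`, `‖h‖_{U,g,∞} = sup_z |h(z)| Im(z)`: "There is a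
number `ν_n > 0` depending only on the degree `n = [F:ℚ]`, such that if `Γ̃_{U,g}` acts freely on
`𝔥`, then for all `h ∈ S_{U,g}` we have `‖h‖_{U,g,∞} ≤ ν_n · ‖h‖_{U,g,2}`." Recorded for `F = ℚ`
(`n = 1`, one absolute `ν`), `U = U₀^D(M)` (so `Γ_{U,1} = O¹ = X.Gamma`), `D > 1` (division
algebra); "acts freely" = only `±1` have fixed points; `‖·‖₂ = X.norm` (on `X.fd`),
`‖·‖_∞ = hypSupNorm`. [cite: PastenShimura2024, Thm. 8.1 p. 29] -/
def PastenShimura2024_thm_8_1 : Prop :=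
  ∃ ν : ℝ, 0 < ν ∧ ∀ {D M : ℕ} (X : ShimuraCurveData D M), 1 < D →
    (∀ γ ∈ X.Gamma, (∃ z : ℍ, γ • z = z) → γ = 1 ∨ γ = -1) →
      ∀ h : CuspForm X.Gamma 2, hypSupNorm h ≤ ν * X.norm h

/-! ### The classical inputs of §16 -/

/-- **Pasten 2024, Corollary 10.2 (= Theorem 1.3): the Manin constant is bounded when additive
reduction is confined to `S`.** Printed (p. 33): "Let `S` be a finite set of primes. There is a
constant `𝓜_S` depending only on `S` such that for every optimal elliptic curve `A` defined over
`ℚ` with semi-stable reduction away from `S` and with associated newform `f ∈ S₂(N)`, we have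
`c_f ≤ 𝓜_S`" (Thm 1.3 p. 4: "`N` squarefree away from `S` (i.e. if `p² ∣ N` for a prime `p`, then
`p ∈ S`)"). Rendering, exactly as the tree's `abs_maninConstant_eq_one_of_isSemistable` renders
Česnavičius (`S = ∅`, `c = ±1`): `W` a globally minimal model (so the datum lattice is the Néron
lattice), `Dt` a datum of minimal degree among all data at level `N` of all elliptic `W'` with the
same newform (so `W` is the `X₀(N)`-optimal curve and `φ_{Dt}` its optimal parametrisation up to
`Aut`, `|Dt.c| = c_f`), `p² ∤ N` for primes `p ∉ S`; conclusion `|c| ≤ 𝓜_S`.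
[cite: PastenShimura2024, Cor. 10.2 p. 33 (= Thm. 1.3 p. 4)] -/
def PastenShimura2024_cor_10_2 : Prop :=
  ∀ S : Finset ℕ, ∃ 𝓜 : ℕ, ∀ (N : ℕ) [NeZero N] (W : WeierstrassCurve ℚ) [W.IsElliptic]
    [W.IsGloballyMinimal] (Dt : ModularParametrizationData W N),
    (∀ p : ℕ, p.Prime → p ∉ S → ¬ p ^ 2 ∣ N) →
    (∀ (W' : WeierstrassCurve ℚ) [W'.IsElliptic] (D' : ModularParametrizationData W' N),
        D'.f = Dt.f → Dt.modularDegree ≤ D'.modularDegree) →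
      |Dt.maninConstant| ≤ 𝓜

/-- **The optimal quotient `X₀(N) → A_{1,N}` as a datum** (Pasten §2 p. 12: "the Eichler–Shimura
construction gives an optimal quotient `q_{1,N} : J₀(N) → A_{1,N}` defined over `ℚ`, with `A_{1,N}`
isogenous to `E`" and "The composition `φ = q_{1,N} j_N : X₀(N) → A_{1,N}` is well-known to have
degree `δ_{1,N}`"; §3 p. 13: "the pull-back of the Néron differential `ω_{A_{1,N}}` to `𝔥` via
`𝔥 → X₀(N) → A_{1,N}` is `2πi c f(z) dz`. The Manin constant is a positive integer (cf.
[Edixhoven])"). Recorded over the tree: for every globally minimal elliptic `W/ℚ` of conductor `N`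
there are a globally minimal elliptic `W₀` (a minimal model of `A_{1,N}`), `ℚ`-isogenous to `W`,
and a datum `D₀ : ModularParametrizationData W₀ N` (the map `q_{1,N} j_N` with `c = c_f ∈ ℤ`,
Néron lattice of `W₀`) whose newform is that of `W` and whose degree is minimal among all data at
level `N` with that newform (every such parametrisation factors through the optimal quotient, so
`D₀.modularDegree = δ_{1,N}`). This is the existence half of the `δ_{1,N}` idiom of
`PastenShimura2024_thm_5_5`; the tree's `nonempty_modularParametrizationData` gives a datum of `W`
itself only. Inputs, kernel-checked in `ShimuraCurveRibetTakahashiOptimalProofs.lean`: Pasten takes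
the newform `f` of `E` from "the modularity theorem [Wiles, TaylorWiles, BCDT]" (§2 p. 12), and the
conjunct `IsNewformOf W D₀.f` makes this statement imply the Modularity theorem `exists_isNewformOf`
(`exists_isNewformOf_of_exists_optimal_modularParametrizationData`); since `W₀` is globally minimal
while `D₀.modularDegree` is minimal over data on arbitrary models, it also implies Edixhoven's
integrality `c_f ∈ ℤ` in lattice form (`int_of_latticeEq_of_exists_optimal_modularParametrizationData`);
conversely it follows from exactly these two inputs
(`exists_optimal_modularParametrizationData_iff_modularity_and_edixhoven`, discharge recipe
`exists_optimal_modularParametrizationData_of_exists_isNewformOf_of_edixhoven`). Edixhoven's input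
is now a theorem of the tree (`edixhoven_int_of_neronLattice_eq_smul_periodLattice_holds`,
`EllipticCurves/ManinConstantDeuringTwistProofs.lean`), so this statement is EQUIVALENT TO THE
MODULARITY THEOREM ALONE (`exists_optimal_modularParametrizationData_iff_modularity`,
`ShimuraCurveRibetTakahashiOptimalModularityProofs.lean`); it is discharged by
`exists_optimal_modularParametrizationData_of_modularity` applied to any proof of
`exists_isNewformOf`, and users of `(h : exists_optimal_modularParametrizationData)` may take
`(hmod : exists_isNewformOf)` instead. At square-free
levels the conclusion, together with `|D₀.c| = 1`, follows from `exists_isNewformOf` and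
Česnavičius 2018, Thm. 1.2 in lattice form alone
(`exists_optimal_and_abs_maninConstant_eq_one_of_squarefree`).
[cite: PastenShimura2024, §2 p. 12 (q_{1,N}, A_{1,N} ∼ E, deg = δ_{1,N}) and §3 p. 13 (c_f ∈ ℤ)]
[cite: BCDTJAMS2001, Thm. A] [cite: EdixhovenManin1991, Prop. 2] -/
def exists_optimal_modularParametrizationData : Prop :=
  ∀ (N : ℕ) [NeZero N] (W : WeierstrassCurve ℚ) [W.IsElliptic] [W.IsGloballyMinimal],
    W.conductorNorm ℤ = N →
      ∃ (W₀ : WeierstrassCurve ℚ) (_ : W₀.IsElliptic) (_ : W₀.IsGloballyMinimal)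
        (D₀ : ModularParametrizationData W₀ N),
        IsNewformOf W D₀.f ∧ W.IsIsogenous W₀ ∧
          ∀ (W₂ : WeierstrassCurve ℚ) [W₂.IsElliptic] (D₂ : ModularParametrizationData W₂ N),
            D₂.f = D₀.f → D₀.modularDegree ≤ D₂.modularDegree

/-- **`‖f‖² ≪ N log N` for the newform of an elliptic curve** — the upper-bound twin of the
tree's `murty_petersson_newform_lower_bound`. Printed in Pasten §16 (proof of Thm 16.1, p. 49):
"Since `f` is a normalized newform for `Γ₀(N)`, from [MaiMurty, MurtyBounds] we get
`‖f‖²_{U₀¹(N),2} ≪ N log N`" (Mai–Murty 1994; Murty, *Bounds for congruence primes*, 1999;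
Rankin–Selberg: `‖f‖² ≍ N · L(1, Sym² f) ·` bounded local factors, `L(1, Sym² f) ≪ log N`).
Rendered with the tree's un-normalised `peterssonProduct (Gamma0 N) 2 f f` (which differs from
`‖f‖²_{2,Γ₀(N)}` by an absolute factor `∈ {1, 2}`, absorbed in `C`), the newform pinned by
`IsNewformOf W f` (`a₁ = 1`), one absolute constant `C` for all levels.

**Caveat (source audit, 2026-08-16): the exponent of `log N` is NOT established by the cited
proof.** Murty 1999, §2 prints "By the Phragmén–Lindelöf theorem, we have
`L(2, sym²(f)) = O(log N)`. Hence `(f,f) ≤ c₂ N log N`", referring to Mai–Murty 1994 ("as in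
[MM]"); but Mai–Murty 1994, §2 prints "`L(1, Sym²(f)) = O((log N)³)`" (Rademacher's
Phragmén–Lindelöf for a degree-`3` Euler product whose conductor `A` has `log A = O(log N)`), which
yields `(f,f) ≪ N (log N)³` only; `log³` of the conductor is the convexity-strength bound at
`s = 1` for a degree-`3` `L`-function satisfying the Ramanujan bound (X. Li, IMRN 2010,
introduction), and `L(1, Sym² f_E) ≪ log N_E` (naive good-prime `L`-function) — to which this
statement is EQUIVALENT by the tree's PROVED Rankin–Selberg identity
(`murty_petersson_newform_upper_bound_iff_symmSq` in `ShimuraCurveRibetTakahashiPeterssonProofs.lean`;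
with the tree's defined naive edge value, literally `symmSqLOne f ≤ C log N`,
`murty_petersson_newform_upper_bound_iff_symmSqLOne`) — is not known to be proved anywhere. The statement the cited proof does establish is
`∃ C, ∀ N W f, IsNewformOf W f → Re (f,f) ≤ C · N · (log N)³` (same rendering); it is the
conclusion of `peterssonProduct_re_le_log_pow_three_of_symmSq_upper_bound` (from the printed
Phragmén–Lindelöf input) and of `peterssonProduct_re_le_log_pow_three_of_murty` (from this
statement) in that file. Pasten's use of the bound, `2 log ‖f‖ ≤ log N + O(log log N)` (p. 49),
follows from either exponent. **That statement — Mai–Murty's printed exponent `3` — is PROVED in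
the tree for squarefree `N`** (every semistable curve — the Frey curves of the `abc` routes), by the
printed Phragmén–Lindelöf argument run on the tree's Rankin–Selberg continuation, no named fact
used: `exists_petersson_le_mul_log_cube_of_squarefree` (an absolute `C > 0` with
`Re (f,f) ≤ C · N · (1 + log N)³` for all squarefree `N`, `E/ℚ`, `f` with `IsNewformOf E f`),
`exists_petersson_le_mul_log_pow_three_of_squarefree` (`≤ C · N · (log N)³`, `N ≥ 3`),
`exists_log_petersson_le_three_of_squarefree` (`log Re (f,f) ≤ log N + 3 log log N + C`), the
power form `exists_petersson_le_mul_rpow_of_squarefree` (`≤ C · N^{1+ε}/ε³` for all `0 < ε ≤ 1`,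
the shape `(f,f) ≪_ε N^{1+ε}` in which the `abc` routes consume this fact) and
`exists_petersson_le_mul_log_cube_of_forall_prime_sq_not_dvd` (hypothesis `∀ p prime, p² ∤ N`) in
`ShimuraCurveRibetTakahashiPeterssonConvexityCubeProofs.lean` (the earlier exponent-`5` versions
`exists_petersson_le_mul_log_pow_of_squarefree` etc. are in
`ShimuraCurveRibetTakahashiPeterssonConvexityProofs.lean`). **Beyond squarefree levels** (the `2`-part
of a non-semistable Frey–Hellegouarch conductor) the same bound is proved, again with no named fact,
in `ShimuraCurveRibetTakahashiPeterssonTwoPowerLevelProofs.lean` for every `N` with `16 ∤ N` and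
squarefree odd part (`exists_petersson_le_mul_log_cube_of_not_sixteen_dvd`: the Fourier expansions
of `f` at ALL cusps of `Γ₀(2ᵗM)`, `t ≤ 3`, are dilates of `f`, giving the Rankin–Selberg dictionary
`N⁻¹ A_t(s) (Σ_{m∣M} m^{-s}) Σ|aₙ|²n^{-(s+1)}`), in
`ShimuraCurveRibetTakahashiPeterssonTwistComparisonProofs.lean` for `16 ∣ N` when the twist
`E^{(−1)}` has a newform `g` of squarefree level (`Re (f,f) ≤ 96 Re (g,g)`), and in
`ShimuraCurveRibetTakahashiPeterssonTwoPowerLevelTwistProofs.lean` for every `N` with `64 ∤ N` and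
squarefree odd part, given the newform `g` of `E^{(−1)}` at ANY level `N'`
(`exists_petersson_le_mul_log_cube_of_not_sixtyfour_dvd'`; at the cusps with quarter-integer
translations `f(τ + 1/4) = i·g(τ)`; the unprimed `exists_petersson_le_mul_log_cube_of_not_sixtyfour_dvd`
carries the level hypothesis `16 ∣ N → 16 ∤ N' ∨ N' = N`, which is the theorem
`IsNewformOf.not_sixteen_dvd_or_level_eq_of_quadraticTwist_neg_one` there — Atkin–Li:
`N ∣ lcm(N', 16)` and `N' ∣ lcm(N, 16)`, `IsNewformOf.level_dvd_lcm_sixteen_of_quadraticTwist_neg_one`)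
— together every level `2ᵗM`, `t ≤ 5`, `M` odd squarefree, which contains the whole Frey–Hellegouarch
class `y² = x(x−a)(x+b)`, `a, b` coprime (for these `64 ∤ N_E` or `64 ∤ N_{E^{(−1)}}` —
Diamond–Kramer's `2`-adic table, the tree's
`IsFreyHellegouarch.not_sixtyfour_dvd_conductorNorm_or_quadraticTwist_neg_one` in
`ShimuraCurveRibetTakahashiPeterssonFreyHellegouarchProofs.lean`, over
`DiophantineGeometry/FreyCurveConductorTwoTwistDichotomyProofs.lean`); power forms
`…_rpow_…` (`≤ C·N^{1+ε}/ε³`, e.g. `exists_petersson_le_mul_rpow_of_not_sixtyfour_dvd'`) and the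
logarithmic form `exists_log_petersson_le_of_not_sixtyfour_dvd`
(`log Re (f,f) ≤ log N + 3 log (1 + log N) + C`) alongside. **Beyond `t ≤ 5` by descent along
quadratic twists**: in `ShimuraCurveRibetTakahashiPeterssonTwistDescentProofs.lean` the bound is
transported from the newform `g` of a twist `E^{(d)}`, `d ∈ {−1, 2, −2}`, to `f`
(`Re (f,f) ≤ 1536 Re (g,g)`, `IsNewformOf.re_petersson_le_of_quadraticTwist_mem`, from the `GL₂`-side
Rankin–Selberg comparison `ψ(N') Re(f,f) ≤ 16 ψ(N) Re(g,g)` and Atkin–Li `N ∣ lcm(N', 64)`), giving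
`exists_petersson_le_mul_log_cube_of_quadraticTwist_not_sixtyfour_dvd` (squarefree odd part, `64 ∤`
the level of `g`; `…_rpow_…`, `exists_log_petersson_le_…` alongside) and, with the newforms of the
twists supplied by the modularity fact `exists_isNewformOf`,
`exists_petersson_le_mul_log_cube_of_exists_isNewformOf`: every `E` with squarefree odd conductor such
that `64 ∤ N_E` or `64 ∤ N_{E^{(d)}}` for some `d ∈ {−1, 2, −2}`. **On the printed class of the `abc`
dependents** (squarefree odd part of `N_E`, and `N_E` squarefree or `E` Frey–Hellegouarch — the
hypotheses `hss`, `hclass` of `jlPackage_printedClass_of_facts`) the printed-strength bound therefore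
holds for EVERY curve: `exists_petersson_le_mul_log_cube_of_printedClass`,
`exists_petersson_le_mul_log_cube_of_isFreyHellegouarch`,
`exists_petersson_le_mul_log_cube_of_isSemistable_or_isFreyHellegouarch` (under `exists_isNewformOf`;
power forms `exists_petersson_le_mul_rpow_of_printedClass`, `…_of_printedClass'` (`≤ C_ε N^{1+ε}`),
`…_of_isFreyHellegouarch`, log form `exists_log_petersson_le_of_printedClass`; modularity-free
`IsFreyHellegouarch.re_petersson_le_of_isNewformOf`, with the newforms of `E`, `E^{(−1)}`,
`(E^{(−1)})^{(−1)}` at conductor level as data) in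
`ShimuraCurveRibetTakahashiPeterssonFreyHellegouarchProofs.lean` — the drop-in replacements for this
fact in its dependents. **The twist-stable levels `2⁶M`, `2⁷M`** (all of `N_E`, `N_{E^{(−1)}}`,
`N_{E^{(±2)}}` divisible by `64`, hence EQUAL by Atkin–Li,
`IsNewformOf.level_eq_of_sixtyfour_dvd_of_quadraticTwist`) are settled in
`ShimuraCurveRibetTakahashiPeterssonTwoPowerLevelSevenProofs.lean`: at the cusps `u/8` one has
`f(τ + u/8) = (√2/2)(χ₈(u) g₂(τ) + iχ₈'(u) g₃(τ))` for the newforms `g₂, g₃` of `E^{(±2)}`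
(`IsNewformOf.apply_eighth_vadd`; `aₙ(g₂) = χ₈(n)aₙ(f)`, `aₙ(g₃) = χ₈'(n)aₙ(f)` at odd `n` and the Gauss
sums mod `8`), the cross terms cancel over `(ℤ/8)ˣ` (`sum_kSet_three_norm_sq_cuspCoeff_eighthComb`), and
the same Phragmén–Lindelöf assembly gives `exists_petersson_le_mul_log_cube_of_two_pow_mul_seven`
(`2 ≤ t ≤ 7`, newforms of `E`, `E^{(−1)}`, `E^{(±2)}` at level `2ᵗM`) and, under `exists_isNewformOf`,
**`exists_petersson_le_mul_log_cube_of_not_two_pow_eight_dvd`: the printed-strength bound for EVERY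
`E/ℚ` whose conductor has squarefree odd part and `2⁸ ∤ N_E`** (power form
`exists_petersson_le_mul_rpow_of_not_two_pow_eight_dvd`, `ε`-form `…_dvd'`, log form
`exists_log_petersson_le_of_not_two_pow_eight_dvd`, conductor-phrased
`exists_petersson_le_mul_log_cube_of_conductorNorm_not_two_pow_eight_dvd` / `…_rpow_…` alongside).
Not covered: `v₂(N) = 8` (the cusps `u/16` need the twists of `f` by the order-`4` characters of
conductor `16`, i.e. newforms with nebentypus `χ₈` — not in the tree), or `p² ∣ N` for an odd prime `p`.
[cite: PastenShimura2024, §16 p. 49 ("‖f‖² ≪ N log N", from [MaiMurty], [MurtyBounds])] [cite: MurtyCongruencePrimes1999] -/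
def murty_petersson_newform_upper_bound : Prop :=
  ∃ C : ℝ, ∀ (N : ℕ) [NeZero N] (W : WeierstrassCurve ℚ) [W.IsElliptic]
    (f : CuspForm (Gamma0 N) 2), IsNewformOf W f →
      (peterssonProduct (Gamma0 N) 2 f f).re ≤ C * N * Real.log N

end Literature.NumberTheory.Automorphic

end

/-! ## Relocated from `Summits/ABC/ABC/Theorems/RibetTakahashiSplitFewPrimeValuationProductStubTwoPrimePackage.lean` (gate, accept-time relocation of cited facts) — PastenShimura2024 -/

namespace Literature.NumberTheory.Automorphic

open MeasureTheory
open scoped MatrixGroups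

/-- **Pasten 2024, the denominator of `γ_{pq,M,E}` for a PAIR of multiplicative primes, bounded by
`gcd(c_p, c_q)²` — (EqSequentially) p. 25 with `d = 1`, assembled with Lemmas 6.8, 6.14, 6.15.**
Printed (proof of Thm 6.1, §6.9 p. 25): "Consider any factorization of `N` of the form `N = dprm`
where `d` is squarefree with an even number of prime factors, `p` and `r` are distinct primes not
dividing `d`, and `m` is coprime to `dpr`. By Proposition 6.13 and Lemma 6.8 we have
`δ_{d,prm}/δ_{dpr,m} = u_{d,p,r,m}/(i_p(d,prm)² j_r(dpr,m)²) · c_p(E) c_r(E)` (EqSequentially) where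
`u_{d,p,r,m}` is certain rational number supported on primes `≤ 163` with multiplicative height at
most `163`"; Lemma 6.8 p. 22: "`c_p(A)/c_p(B)` is a rational number whose multiplicative height is
at most `163`" (so `u = [c_p(A_{1,N})/c_p(E)]·[c_r(A_{pr,m})/c_r(E)]` has numerator and
denominator `≤ 163²`); Lemma 6.14 p. 23: "if `N = DM` is squarefree away from `S`, and `p` exactly
divides `M`, then `i_p(J₀^D(M), χ_{D,M})` divides an integer `κ_S` which only depends on the set
`S`"; Lemma 6.15 p. 24 (no hypothesis on `M`): "There is a function `α_{S,1} : 𝒫 → ℤ_{≥0}`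
supported on primes `≤ 163` … Let `E` be an elliptic curve over `ℚ`, semi-stable away from `S`,
and of conductor `N`. Let `N = DM` be an admissible factorization. If `p, r` are two (possibly
equal) primes dividing `D`, then for every prime `ℓ` we have `v_ℓ(j_p(D,M)) ≤ v_ℓ(c_r(E)) +
α_{S,1}(ℓ)`." ASSEMBLED CONSEQUENCE recorded here (`d = 1`, `m = M`, primes `p`, `r = q`,
`c_v(E) = v_v(Δ_E)` p. 22): `i_p(1,N) ∣ κ_S`, and Lemma 6.15 for `r = p` and `r = q` gives
`j_q(pq,M) ∣ κ₁ · gcd(c_p(E), c_q(E))`, `κ₁ = ∏_ℓ ℓ^{α_{S,1}(ℓ)}`; hence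
`δ_{1,N} · b = a · δ_{pq,M} · c_p(E) c_q(E)` with `a = num(u) ≤ 163²` and
`b = den(u) i_p(1,N)² j_q(pq,M)² ≤ κ · gcd(c_p,c_q)²`, `κ = 163² κ_S² κ₁²` depending only on `S`.
Rendering exactly as `PastenShimura2024_thm_6_1_b`: `E` = a globally minimal `W` of conductor
`N = (pq) M` (admissible), "semi-stable away from `S`" = `r² ∤ N` for primes `r ∉ S` (Thm 1.3
p. 4), `δ_{1,N} = D₁.modularDegree` for a classical datum `D₁` with the newform of `W` of minimal
degree among all data at level `N` with that newform, `δ_{pq,M} = P.deg` for `P.IsMinimalFor W`.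
The general `d` of (EqSequentially) is not stated (only `d = 1` is consumed).

**Status (review of 2026-08-16, source open: Lemma 6.8 p. 22, §6.6, Prop. 6.13 and Lemma 6.14 p. 23,
Lemma 6.15 p. 24, §6.9 (EqSequentially) p. 25).** Audited against the printed inputs: at `d = 1`,
`D = pq`, (EqSequentially) reads `δ_{1,N}/δ_{pq,M} = u/(i_p(1,N)² j_q(pq,M)²) · c_p(E) c_q(E)` with
`u = [c_p(A_{1,N})/c_p(E)] · [c_q(A_{pq,M})/c_q(E)]` of numerator and denominator `≤ 163²` (Lemma
6.8 twice; the printed "multiplicative height at most `163`" of `u` is not used); `i_p(1,N) ∣ κ_S`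
is Lemma 6.14 at the factorisation `N = 1 · N` (squarefree away from `S`, `p ∥ N`);
`j_q(pq,M) ∣ κ₁ · gcd(c_p(E), c_q(E))` is Lemma 6.15 at `(D, p, r) = (pq, q, p)` and `(pq, q, q)`;
whence `b = den(u) · i_p(1,N)² · j_q(pq,M)² ≤ (163² κ_S² κ₁²) · gcd(c_p, c_q)²` — the statement,
with `κ` depending only on `S`. A faithful consequence of theorems in print: not mis-stated, not
open, not stronger than its source (it drops "`κ`, `a` supported on primes `≤ 163`"); not a
decomposition child of another fact of the tree (it serves `stub_twoPrimePackage_of_facts` under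
`Summits/ABC` directly, in the few-prime regime where Thm. 6.1 (b) has no admissible level). Not
provable inline, and nothing of Pasten's is missing: ALL of Pasten's own steps are theorems of the
tree — the assembly and Lemmas 6.14/6.15 performed in
`ShimuraCurveRibetTakahashiPairwiseDenominatorProofs.lean`
(`PastenShimura2024_pairwise_denominator_of_lemmas`, `…_of_ribetTakahashi_inputs`,
`…_of_ribetTakahashi_eisenstein_mazurKenku`), and WITHOUT the Jacquet–Langlands fact in
`ShimuraCurveRibetTakahashiPairwiseNoJLProofs.lean` (`…_noJL`: the level-`(1, N)` datum of
(EqSequentially) at `d = 1` and of the switching in Lemma 6.15 at `D = pq` is the transported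
classical datum `D₁` of the statement, `X₀^1(N) = X₀(N)`). So the discharge
`PastenShimura2024_pairwise_denominator_holds` waits exactly for the EXTERNAL theorems the printed
proof quotes, over a vocabulary neither Mathlib nor the tree has (Néron models and the component
groups `Φ_p` of `J₀^D(M)` and of `q_{D,M}`, the orders `i_p`, `j_p` of §6.6): Prop. 6.13 =
Ribet–Takahashi 1997 Thm. 2 (consumed at `d = 1`, `D = pq` only), "`j_q(pq,M) ∣ #Φ_q(A_{pq,M})`",
Ribet's Eisenstein property of `Φ_p(J₀(N))` with Lemma 6.7 (⟹ Lemma 6.14); and the ONE named fact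
`Literature.NumberTheory.EllipticCurves.mazurKenku_exists_cyclic_isogeny` (Lemma 6.8). Nothing
automorphic (the Modularity theorem, `nonempty_shimuraParametrizationData`) is on its path: the
statement quantifies over the classical datum `D₁` and over the Shimura data at level `(pq, M)`.
[cite: PastenShimura2024, §6.9 (EqSequentially) p. 25 with d = 1, Lemma 6.8 p. 22, Lemma 6.14 p. 23, Lemma 6.15 p. 24]
[file NumberTheory/Automorphic/ShimuraCurveRibetTakahashi] -/
def PastenShimura2024_pairwise_denominator : Prop :=
  ∀ S : Finset ℕ, ∃ κ : ℕ, 1 ≤ κ ∧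
  ∀ {N M p q : ℕ} [NeZero N], p.Prime → q.Prime → p ≠ q →
    Literature.NumberTheory.Automorphic.IsAdmissibleFactorization N (p * q) M →
    ∀ (X : Literature.NumberTheory.Automorphic.ShimuraCurveData (p * q) M)
      (W : WeierstrassCurve ℚ) [W.IsElliptic] [W.IsGloballyMinimal],
      W.conductorNorm ℤ = N → (∀ r : ℕ, r.Prime → r ∉ S → ¬ r ^ 2 ∣ N) →
    ∀ (W₁ : WeierstrassCurve ℚ) [W₁.IsElliptic]
      (D₁ : Literature.NumberTheory.EllipticCurves.ModularForms.ModularParametrizationData W₁ N),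
      Literature.NumberTheory.EllipticCurves.ModularForms.IsNewformOf W D₁.f →
      (∀ (W₂ : WeierstrassCurve ℚ) [W₂.IsElliptic]
          (D₂ : Literature.NumberTheory.EllipticCurves.ModularForms.ModularParametrizationData W₂ N),
          D₂.f = D₁.f → D₁.modularDegree ≤ D₂.modularDegree) →
    ∀ (W' : WeierstrassCurve ℚ) [W'.IsElliptic]
      (P : Literature.NumberTheory.Automorphic.ShimuraParametrizationData X W'),
      P.IsMinimalFor W →
        ∃ a b : ℕ, 0 < a ∧ 0 < b ∧ a ≤ 163 ^ 2 ∧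
          b ≤ κ * (Nat.gcd ((W.minimalDiscriminantNorm ℤ).factorization p)
            ((W.minimalDiscriminantNorm ℤ).factorization q)) ^ 2 ∧
          D₁.modularDegree * b = a * P.deg *
            ((W.minimalDiscriminantNorm ℤ).factorization p *
              (W.minimalDiscriminantNorm ℤ).factorization q)

end Literature.NumberTheory.Automorphic
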